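import Summits.HodgeConjecture.HodgeConjecture.Theorems.LinearSystemTorelliTranscendentalOrSupportedStubOfMiddleOfPhantomGysin
import Summits.HodgeConjecture.HodgeConjecture.Theorems.LinearSystemTorelliAssembly
import Summits.HodgeConjecture.HodgeConjecture.Theorems.LimitExtensionDivisorInduction
import Summits.HodgeConjecture.HodgeConjecture.Theorems.LinearSystemTorelliHardLefschetzReduction
import Literature.AlgebraicGeometry.HodgeTheory.ComplexGysinCorrespondence
import Literature.AlgebraicGeometry.HodgeTheory.SupportedHodgeClassDescent
import Literature.AlgebraicGeometry.HodgeTheory.ComplexOrientationCycleClassFacts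
import Literature.AlgebraicGeometry.HodgeTheory.AlgebraicClassesHodgeTypeHolds
import Literature.AlgebraicGeometry.HodgeTheory.GysinFormalismHodgeOfGysin
import Summits.HodgeConjecture.HodgeConjecture.Theorems.LinearSystemTorelliTranscendentalOrSupportedStubResidueNecessary

/-!
# Crux `TranscendentalOrSupported` (stmt-HodgeConjecture-10853) — line `HodgeEffectivity`
# (strategist line; Voisin's Proposition 4.8 typed against the route's own Hodge-conjecture items)

Route `LinearSystemTorelli`, crux `TranscendentalOrSupported` = GHC(2p, coniveau 1) in Grothendieck's
sub-Hodge form: for `X` smooth projective of dimension `2p` (`p ≥ 1`), a Hodge model `A`, rational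
classes `b j ∈ H²ᵖ(X(ℂ); ℂ)` whose pulled-back span `W` is a sub-Hodge structure with
`W ∩ H^{2p,0} = 0`, every `b j` lies in `N¹ H²ᵖ = supportedClasses X (2p) 1`.

## The line

The two dead lines (`Sketch`, `Sketch_chow_shadow`) both died at a stub that still CONTAINED the
Hodge conjecture: the Gysin residue `stub_phantomGysin` ("a phantom constituent meets a Gysin image
from a variety of smaller dimension INSIDE `X`") and `stub_cohTDD` ("an algebraic self-correspondence
of `X` …") ask for algebraic cycles. This line separates the crux EXACTLY into

* its Hodge-conjecture part, paid with EXISTING route items only: `stub_middle` = item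
  stmt-HodgeConjecture-1081 `MiddleDivisorSupport` and `stub_pencil` = item stmt-HodgeConjecture-1083
  `PencilReduction` (Thomas 2005 Prop. 2, a theorem in print). With the CLOSED items `HodgeModels`,
  `DivisorInduction`, `HardLefschetzReduction` and the CLOSED assembly item 1085
  (`Theorems.linearSystemTorelli_assembly_proof`) these two give the full Hodge conjecture
  (`hodgeConjecture_of_middle_of_pencil` below, sorry-free) — the crux already implies 1081 (closed
  glue item 2411) and 1081 is HC-strength (Thomas 2005 Thm. 1), so nothing is added to the crux;
* ONE purely Hodge-theoretic stub `stub_hodgeEffective` = Voisin's Conjecture 4.7 (J. Open Math.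
  Probl. 1 (2025) §4.2) for the coniveau-1 phantom constituents of `H²ᵖ(X^{2p})`, in the
  Hodge-CORRESPONDENCE form given by her Lemma 2.9 (an isomorphism of Hodge structures between
  sub-Hodge structures of the cohomology of two smooth projective varieties is induced by a Hodge
  class on the product): every irreducible rationally spanned sub-Hodge structure `W ⊆ H²ᵖ(X(ℂ); ℂ)`
  of rank `≥ 2` without `(2p,0)`-part lies in the sum of the images of the actions
  `κ_* = pr_{X*}(pr_Y^*(–) ∪ κ) : Hᵃ(Y(ℂ); ℂ) → H²ᵖ(X(ℂ); ℂ)` of RATIONAL HODGE classes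
  `κ ∈ H^{2e}((X ⊗ Y)(ℂ); ℂ)` of type `(e,e)` on products with smooth projective `Y` (any dimension
  `m`), from degrees `a = 2p + 2m - 2e ≤ 2p - 2` (`e ≥ m + 1`): "the Tate twist `W(1)` is effective,
  i.e. cut out by Hodge classes from lower-degree cohomology of smooth projective varieties". No cycle,
  no divisor, no Chow group is asked of this stub.

COMPOSITION (`TranscendentalOrSupported_of`, sorry-free; Voisin's proof of Prop. 4.8 on the tree's
real carriers): the Hodge conjecture makes each such `κ` algebraic, i.e. `κ ∈ Nᵉ H^{2e}(X ⊗ Y)`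
(`algebraicClasses = supportedClasses _ (2e) e`), so `κ` dies off a closed `Z ⊆ X ⊗ Y` of
codimension `≥ e ≥ m + 1`; then `pr_Y^* c ∪ κ` dies off `Z` (`cupProduct_map`) and its Gysin image
under `pr_X : X ⊗ Y → X` (relative dimension `m`) is supported in codimension `≥ e - m ≥ 1`
(`complexGysin_mem_supportedClasses`, Fulton App. B Ex. 5 + codimension count, all PROVED in the
tree incl. Poincaré duality `OrientationFamily.hasPoincareDuality`). Hence the whole supremum of
Hodge-correspondence images lies in `N¹ H²ᵖ(X)` (`hodgeCorrespondences_le_supportedClasses`), and the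
landed induction engine `Theorems.isotypic_le_supportedClasses_of_ingredients` (p117181: semisimple
splitting `stub_completelyReducible` p107582 + polarizability p112211, Hodge lines `stub_rankOne`
p107230 supported by `stub_middle`, phantoms by `stub_hodgeEffective` + the above) gives `W ≤ N¹`.

TIGHTNESS (paper, as for the dead lines): crux ⟹ `stub_hodgeEffective` modulo Deligne's Cor. 8.2.8
(`N¹ = G¹`, `Theorems.residue_supportedClasses_le_iSupGysin`) because a Gysin map `g_*` IS the action
of the rational Hodge class `(g, 𝟙)_* 1` (`CorrespondenceActionOfGraph`); and GHC ⟹ Conj. 4.7 in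
print (Voisin 2025, sentence before Conj. 4.7). So modulo classical theorems
crux = (1081 ∧ 1083) ∧ `stub_hodgeEffective` = HC ∧ Conj 4.7(2p, 1): "The Hodge conjecture itself
does not imply the generalized Hodge conjecture" (loc. cit.) is precisely the statement that the third
stub is the crux's content beyond the summit.

References: C. Voisin, J. Open Math. Probl. 1 (2025) 16–51, Lemma 2.9, Conj. 4.6–4.7, Prop. 4.8;
A. Grothendieck, Topology 8 (1969) 299–303; R. Thomas, J. Algebraic Geom. 14 (2005), Thm. 1, Prop. 2;
S. Abdulali, Compositio Math. 109 (1997) 341–355 and J. Ramanujan Math. Soc. 20 (2005) (CM / abelian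
sectors of Conj. 4.7); B. van Geemen, J. Math. Soc. Japan 53 (2001) (half twists).
-/

noncomputable section

set_option linter.dupNamespace false

open CategoryTheory MonoidalCategory CartesianMonoidalCategory
open Literature.AlgebraicGeometry.Motives Literature.AlgebraicGeometry.HodgeTheory
open Literature.AlgebraicTopology.SingularHomology
open Summit.HodgeConjecture.HodgeConjecture.Theorems

namespace Summit.HodgeConjecture.HodgeConjecture.Cruxes.TranscendentalOrSupported.HodgeEffectivity

/-! ### Registered stubs -/

/-- STUB `stub_middle` (= route item `MiddleDivisorSupport`, stmt-HodgeConjecture-1081, VERBATIM; it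
closes by name when that item lands): every rational `(p,p)`-class in `H²ᵖ` of a smooth projective
`2p`-fold (`p ≥ 1`) is supported on a divisor — the Hodge-conjecture part of the crux (Thomas 2005
Thm. 1). Used twice: for the Hodge lines inside `W`, and (with `stub_pencil`) to obtain the Hodge
conjecture for the products `X ⊗ Y`. -/
theorem stub_middle :
    Summit.HodgeConjecture.HodgeConjecture.Theses.LinearSystemTorelli.MiddleDivisorSupport := by
  sorry

/-- STUB `stub_pencil` (= route item `PencilReduction`, stmt-HodgeConjecture-1083, VERBATIM; a theorem
in print — Thomas 2005 Prop. 2, Kerr–Pearlstein 2011 §3.1 — with partial tree files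
`Theorems/LinearSystemTorelliPencilReduction*.lean`): Lefschetz-pencil reduction of HC below the
middle degree. With `stub_middle` and the closed items it yields the Hodge conjecture in every
dimension and codimension (`hodgeConjecture_of_middle_of_pencil`). -/
theorem stub_pencil :
    Summit.HodgeConjecture.HodgeConjecture.Theses.LinearSystemTorelli.PencilReduction := by
  sorry

/-- STUB `stub_hodgeEffective` (THE BET — Voisin's Conjecture 4.7 for coniveau-1 phantom constituents
of `H²ᵖ(X^{2p})`, Hodge-correspondence form; pure Hodge theory, no cycles): for `X` smooth projective
of dimension `2p` (`p ≥ 1`), a Hodge model `A` and rational `b j` whose span `W` pulls back to an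
IRREDUCIBLE sub-Hodge structure of rank `≥ 2` without `(2p,0)`-part, `W` lies in the sum of the images
of the correspondence actions `κ_* = pr_{X*}(pr_Y^* – ∪ κ) : Hᵃ(Y(ℂ); ℂ) → H²ᵖ(X(ℂ); ℂ)`
(`corrAction`, the tree's real Gysin/cup/pull-back formula) of RATIONAL classes `κ` of HODGE TYPE
`(e,e)` on `X ⊗ Y`, over all smooth projective `Y` of all dimensions `m`, all orientation families
`μ`, and all degrees with `a + 2e = 2p + 2m`, `e ≥ m + 1` (so `a ≤ 2p - 2`: the classes come from
LOWER-degree cohomology — effectivity of the Tate twist `W(1)`). Equivalent (Künneth + Poincaré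
duality = Voisin's Lemma 2.9, semisimplicity) to: `W(1)` is isomorphic to a sub-Hodge structure of
`H^{2p-2}(Y', ℚ)` for some smooth projective `Y'`. Implied by the crux modulo Deligne 8.2.8; together
with HC it implies the crux (this file); NOT known to follow from HC. Known sectors: `W(1)` of CM type
(Abdulali 2005: every polarizable effective CM Hodge structure is abelian-geometric), `W` inside the
tensor algebra of `H¹` of an abelian variety with semisimple Hodge group (Abdulali 1997), K3-type
weight-2 pieces (Kuga–Satake), `Λ²T(S)(1) ⊂ H²(KS(S) × KS(S))` for a K3 surface `S`. Why it might
fail: a phantom `W` whose twist `W(1)`, although formally Griffiths-transversal, lies in the cohomology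
of no smooth projective variety — this would refute GHC(2p,1) but not HC. -/
theorem stub_hodgeEffective :
    ∀ ⦃p : ℕ⦄ ⦃X : SchemeOver ℂ⦄, 1 ≤ p → ∀ (hX : IsSmoothProjective (2 * p) X)
    (A : HodgeModel (2 * p) X) (r : ℕ) (b : Fin r → complexBetti X (2 * p)),
    (∀ j, IsRationalClass (b j)) →
    (Submodule.span ℂ (Set.range b)).map (A.pullback (2 * p)).hom =
      ⨆ (p' : ℕ) (q' : ℕ) (_ : p' + q' = 2 * p),
        (Submodule.span ℂ (Set.range b)).map (A.pullback (2 * p)).hom ⊓ A.hodgePQ (2 * p) p' q' →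
    (Submodule.span ℂ (Set.range b)).map (A.pullback (2 * p)).hom ⊓ A.hodgePQ (2 * p) (2 * p) 0 = ⊥ →
    (∀ V : Submodule ℂ (complexBetti X (2 * p)), V ≤ Submodule.span ℂ (Set.range b) →
      Submodule.span ℂ {x : complexBetti X (2 * p) | x ∈ V ∧ IsRationalClass x} = V →
      V.map (A.pullback (2 * p)).hom =
        ⨆ (p' : ℕ) (q' : ℕ) (_ : p' + q' = 2 * p),
          V.map (A.pullback (2 * p)).hom ⊓ A.hodgePQ (2 * p) p' q' →
      V = ⊥ ∨ V = Submodule.span ℂ (Set.range b)) →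
    2 ≤ Module.finrank ℂ (Submodule.span ℂ (Set.range b)) →
    Submodule.span ℂ (Set.range b) ≤
      ⨆ (μ : OrientationFamily) (m : ℕ) (Y : SchemeOver ℂ) (hY : IsSmoothProjective m Y)
        (a : ℕ) (e : ℕ) (hab : a + 2 * e = 2 * p + 2 * m) (_ : m + 1 ≤ e)
        (κ : complexBetti (X ⊗ Y) (2 * e)) (_ : IsRationalClass κ)
        (_ : IsOfHodgeType (2 * p + m) (X ⊗ Y) (2 * e) e e κ),
        LinearMap.range (corrAction μ hX hY hab κ) := by
  sorry

/-! ### Glue (sorry-free) -/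

/-- **The Hodge conjecture from the route's two open reduction items**: `MiddleDivisorSupport`
(item 1081) and `PencilReduction` (item 1083) imply `HodgeConjecture`, by the CLOSED assembly item 1085
(`linearSystemTorelli_assembly_proof`: strong induction on the dimension, inner induction on the
codimension) fed with the theorems `nonempty_hodgeModel_holds` (item 1943 `HodgeModels`),
`linearSystemTorelli_divisorInduction_proof` (item 1082) and
`linearSystemTorelli_hardLefschetzReduction_proof` (item 1084). -/
theorem hodgeConjecture_of_middle_of_pencil
    (hMid : Summit.HodgeConjecture.HodgeConjecture.Theses.LinearSystemTorelli.MiddleDivisorSupport)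
    (hPR : Summit.HodgeConjecture.HodgeConjecture.Theses.LinearSystemTorelli.PencilReduction) :
    _root_.HodgeConjecture :=
  linearSystemTorelli_assembly_proof (fun _ _ ↦ nonempty_hodgeModel_holds)
    linearSystemTorelli_divisorInduction_proof hPR linearSystemTorelli_hardLefschetzReduction_proof hMid

/-- **Under the Hodge conjecture, a rational Hodge class `κ` of type `(e,e)` on `X ⊗ Y`
(`dim X = n`, `dim Y = m`, `e ≥ m + s`) acts `Hᵃ(Y(ℂ)) → Hᵇ(X(ℂ))` INTO `Nˢ Hᵇ(X)`** (Voisin 2025,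
proof of Prop. 4.8): HC puts `κ` in `algebraicClasses (X ⊗ Y) e = Nᵉ H^{2e}`, so `κ` dies off one
closed `Z` of codimension `≥ e` (`exists_isClosed_of_mem_supportedClasses`); `pr_Y^* c ∪ κ` dies off
`Z` too (`cupProduct_map`), and `pr_{X*}` of a class supported in codimension `≥ e` on the
`(n + m)`-fold `X ⊗ Y` is supported in codimension `≥ e - m` on `X`
(`complexGysin_mem_supportedClasses`, with the theorems `gysinMap_restrictCompl_eq_zero_of_field ℂ`
and `OrientationFamily.hasPoincareDuality`). -/
theorem corrAction_mem_supportedClasses_of_hodgeConjecture (hHC : _root_.HodgeConjecture)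
    (μ : OrientationFamily) {n m : ℕ} {X Y : SchemeOver ℂ} (hX : IsSmoothProjective n X)
    (hY : IsSmoothProjective m Y) {a e b s : ℕ} (hab : a + 2 * e = b + 2 * m) (he : m + s ≤ e)
    {κ : complexBetti (X ⊗ Y) (2 * e)} (hκ : IsRationalClass κ)
    (hκt : IsOfHodgeType (n + m) (X ⊗ Y) (2 * e) e e κ) (c : complexBetti Y a) :
    corrAction μ hX hY hab κ c ∈ supportedClasses X b s := by
  have hκalg : κ ∈ supportedClasses (X ⊗ Y) (2 * e) e :=
    (hHC (IsSmoothProjective.tensor_holds hX hY)).2 e κ hκ hκt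
  obtain ⟨Z, hZcl, hZcod, hκZ⟩ := exists_isClosed_of_mem_supportedClasses hκalg
  rw [corrAction_apply]
  refine complexGysin_mem_supportedClasses (gysinMap_restrictCompl_eq_zero_of_field ℂ) μ
    μ.hasPoincareDuality (IsSmoothProjective.tensor_holds hX hY) hX (fst X Y) _ (r := e) (s := s)
    (by omega) ?_
  refine mem_supportedClasses_of_restrictCompl_eq_zero hZcl hZcod ?_
  rw [complexBetti.restrictCompl, cupProduct_map]
  rw [complexBetti.restrictCompl] at hκZ
  rw [hκZ, map_zero]

/-- **Under the Hodge conjecture the whole supremum of Hodge-correspondence images from lower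
degrees lies in `N¹ H²ᵖ(X)`** (`e ≥ m + 1` gives codimension `≥ 1` on `X`). -/
theorem hodgeCorrespondences_le_supportedClasses_of_hodgeConjecture (hHC : _root_.HodgeConjecture)
    {p : ℕ} {X : SchemeOver ℂ} (hX : IsSmoothProjective (2 * p) X) :
    (⨆ (μ : OrientationFamily) (m : ℕ) (Y : SchemeOver ℂ) (hY : IsSmoothProjective m Y)
        (a : ℕ) (e : ℕ) (hab : a + 2 * e = 2 * p + 2 * m) (_ : m + 1 ≤ e)
        (κ : complexBetti (X ⊗ Y) (2 * e)) (_ : IsRationalClass κ)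
        (_ : IsOfHodgeType (2 * p + m) (X ⊗ Y) (2 * e) e e κ),
        LinearMap.range (corrAction μ hX hY hab κ)) ≤ supportedClasses X (2 * p) 1 := by
  refine iSup_le fun μ ↦ iSup_le fun m ↦ iSup_le fun Y ↦ iSup_le fun hY ↦ iSup_le fun a ↦
    iSup_le fun e ↦ iSup_le fun hab ↦ iSup_le fun he ↦ iSup_le fun κ ↦ iSup_le fun hκ ↦
    iSup_le fun hκt ↦ ?_
  rintro _ ⟨c, rfl⟩
  exact corrAction_mem_supportedClasses_of_hodgeConjecture hHC μ hX hY hab he hκ hκt c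

/-! ### Tightness: the crux implies `stub_hodgeEffective` (modulo Deligne's Cor. 8.2.8) -/

/-- **Push–pull for the graph of a morphism between two varieties** (Fulton §16.1): for
`g : Y ⟶ X` (`dim Y = m`, `dim X = n`) the Gysin image `γ = (g, 𝟙)₊ 1 ∈ H^{2n}((X ⊗ Y)(ℂ); ℂ)` of
`1 ∈ H⁰(Y(ℂ); ℂ)` under `lift g (𝟙 Y) : Y ⟶ X ⊗ Y` acts by `[γ]_* = g₊ ∘ (𝟙 Y)^*` (projection
formula `complexGysin_cup`, `∪ 1 = id`, `lift_snd`, functoriality `complexGysin_comp`, `lift_fst`). -/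
theorem corrAction_gysinGraph_one_two {μ : OrientationFamily} (hμ : μ.HasPoincareDuality) {n m : ℕ}
    {X Y : SchemeOver ℂ} (hX : IsSmoothProjective n X) (hY : IsSmoothProjective m Y) (g : Y ⟶ X)
    {a b : ℕ} (hab : a + 2 * n = b + 2 * m) :
    corrAction μ hX hY hab
        (complexGysin μ hY (IsSmoothProjective.tensor_holds hX hY) (lift g (𝟙 Y))
          (show 0 + 2 * (n + m) = 2 * n + 2 * m by omega)
          (singularCohomology.one ℂ (ComplexPoints Y))) =
      complexGysin μ hY hX g hab ∘ₗ (complexBetti.map (𝟙 Y) a).hom := by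
  have hXY := IsSmoothProjective.tensor_holds hX hY
  refine LinearMap.ext fun β ↦ ?_
  rw [corrAction_apply, LinearMap.comp_apply,
    ← complexGysin_cup hμ hY hXY (lift g (𝟙 Y)) (Nat.add_zero a)
      (show a + 2 * (n + m) = a + 2 * n + 2 * m by omega)
      (show 0 + 2 * (n + m) = 2 * n + 2 * m by omega) rfl
      (complexBetti.map (snd X Y) a β) (singularCohomology.one ℂ (ComplexPoints Y)),
    cupProduct_one, ← CategoryTheory.comp_apply, ← complexBetti.map_comp, lift_snd,
    ← LinearMap.comp_apply (f := complexGysin μ hXY hX (fst X Y) _),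
    ← complexGysin_comp hμ hY hXY hX (lift g (𝟙 Y)) (fst X Y)]
  simp only [lift_fst]

/-- **TIGHTNESS of the line: the crux implies `stub_hodgeEffective`, granted Deligne's Cor. 8.2.8**
(the named fact `Deligne1974_ker_restrictCompl_eq_iSup_range_complexGysin`, hypothesis `hD`, exactly as
in `Theorems.stub_phantomGysin_of_transcendentalOrSupported`, p117363): the crux puts the span `W` of
the `b j` in `N¹ = G¹` (`residue_supportedClasses_le_iSupGysin`), and every Gysin image
`im (g₊ : Hᵃ(Y) → H²ᵖ(X))`, `dim Y = m < 2p`, IS the image of the Hodge correspondence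
`κ = (g, 𝟙)₊ 1 ∈ H^{2·2p}((X ⊗ Y)(ℂ); ℂ)` — rational for the complex orientation family
(`isRationalClass_complexGysin_complexOrientationFamily`, `isRationalClass_one`), of Hodge type
`(2p, 2p)` because algebraic (`complexGysin_mem_algebraicClasses`,
`isOfHodgeType_of_mem_algebraicClasses_of_isSmoothProjective`), from degree `a = 2m - 2p ≤ 2p - 2`
(`e = 2p ≥ m + 1`). So modulo one classical theorem the three stubs are EXACTLY the crux:
`stub_hodgeEffective` is the crux minus the Hodge conjecture. (Irreducibility, rank and the
`(2p,0)`-condition are carried, not used.) [cite: Voisin2025, §4.2 (sentence before Conj. 4.7)] -/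
theorem stub_hodgeEffective_of_crux (hD : Deligne1974_ker_restrictCompl_eq_iSup_range_complexGysin)
    (hT : Summit.HodgeConjecture.HodgeConjecture.Theses.LinearSystemTorelli.TranscendentalOrSupported) :
    ∀ ⦃p : ℕ⦄ ⦃X : SchemeOver ℂ⦄, 1 ≤ p → ∀ (hX : IsSmoothProjective (2 * p) X)
    (A : HodgeModel (2 * p) X) (r : ℕ) (b : Fin r → complexBetti X (2 * p)),
    (∀ j, IsRationalClass (b j)) →
    (Submodule.span ℂ (Set.range b)).map (A.pullback (2 * p)).hom =
      ⨆ (p' : ℕ) (q' : ℕ) (_ : p' + q' = 2 * p),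
        (Submodule.span ℂ (Set.range b)).map (A.pullback (2 * p)).hom ⊓ A.hodgePQ (2 * p) p' q' →
    (Submodule.span ℂ (Set.range b)).map (A.pullback (2 * p)).hom ⊓ A.hodgePQ (2 * p) (2 * p) 0 = ⊥ →
    (∀ V : Submodule ℂ (complexBetti X (2 * p)), V ≤ Submodule.span ℂ (Set.range b) →
      Submodule.span ℂ {x : complexBetti X (2 * p) | x ∈ V ∧ IsRationalClass x} = V →
      V.map (A.pullback (2 * p)).hom =
        ⨆ (p' : ℕ) (q' : ℕ) (_ : p' + q' = 2 * p),
          V.map (A.pullback (2 * p)).hom ⊓ A.hodgePQ (2 * p) p' q' →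
      V = ⊥ ∨ V = Submodule.span ℂ (Set.range b)) →
    2 ≤ Module.finrank ℂ (Submodule.span ℂ (Set.range b)) →
    Submodule.span ℂ (Set.range b) ≤
      ⨆ (μ : OrientationFamily) (m : ℕ) (Y : SchemeOver ℂ) (hY : IsSmoothProjective m Y)
        (a : ℕ) (e : ℕ) (hab : a + 2 * e = 2 * p + 2 * m) (_ : m + 1 ≤ e)
        (κ : complexBetti (X ⊗ Y) (2 * e)) (_ : IsRationalClass κ)
        (_ : IsOfHodgeType (2 * p + m) (X ⊗ Y) (2 * e) e e κ),
        LinearMap.range (corrAction μ hX hY hab κ) := by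
  intro p X hp hX A r b hb hsub hbot _ _
  have hN : Submodule.span ℂ (Set.range b) ≤ supportedClasses X (2 * p) 1 := by
    rw [Submodule.span_le]
    rintro _ ⟨j, rfl⟩
    exact hT hp hX A r b hb hsub hbot j
  refine hN.trans ((residue_supportedClasses_le_iSupGysin hD hX (2 * p)).trans ?_)
  refine iSup_le fun μ ↦ iSup_le fun m ↦ iSup_le fun hm ↦ iSup_le fun Y ↦ iSup_le fun hY ↦
    iSup_le fun g ↦ iSup_le fun a ↦ iSup_le fun hab ↦ ?_
  -- switch to the complex orientation family, whose Gysin maps preserve rationality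
  set ν : OrientationFamily := complexOrientationFamily with hν
  rw [range_complexGysin_eq_of_orientationFamily ν.hasPoincareDuality μ.hasPoincareDuality hY hX g hab]
  -- the graph class `κ = (g, 𝟙)₊ 1 ∈ H^{2·2p}(X ⊗ Y)`
  set κ : complexBetti (X ⊗ Y) (2 * (2 * p)) :=
    complexGysin ν hY (IsSmoothProjective.tensor_holds hX hY) (lift g (𝟙 Y))
      (show 0 + 2 * (2 * p + m) = 2 * (2 * p) + 2 * m by omega)
      (singularCohomology.one ℂ (ComplexPoints Y)) with hκ
  have hκrat : IsRationalClass κ :=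
    isRationalClass_complexGysin_complexOrientationFamily hY _ _ _ (isRationalClass_one _)
  have hκalg : κ ∈ algebraicClasses (X ⊗ Y) (2 * p) :=
    complexGysin_mem_supportedClasses (gysinMap_restrictCompl_eq_zero_of_field ℂ) ν
      ν.hasPoincareDuality hY (IsSmoothProjective.tensor_holds hX hY) (lift g (𝟙 Y)) _ (r := 0)
      (by omega) (by rw [supportedClasses_zero]; exact Submodule.mem_top)
  have hκt : IsOfHodgeType (2 * p + m) (X ⊗ Y) (2 * (2 * p)) (2 * p) (2 * p) κ :=
    isOfHodgeType_of_mem_algebraicClasses_of_isSmoothProjective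
      (IsSmoothProjective.tensor_holds hX hY) (2 * p) hκalg
  refine le_iSup_of_le ν (le_iSup_of_le m (le_iSup_of_le Y (le_iSup_of_le hY (le_iSup_of_le a
    (le_iSup_of_le (2 * p) (le_iSup_of_le hab (le_iSup_of_le (by omega) (le_iSup_of_le κ
    (le_iSup_of_le hκrat (le_iSup_of_le hκt ?_))))))))))
  rw [hκ, corrAction_gysinGraph_one_two ν.hasPoincareDuality hX hY g hab, complexBetti.map_id]
  rintro _ ⟨y, rfl⟩
  exact ⟨y, rfl⟩

/-! ### The crux by name -/

/-- **The crux `TranscendentalOrSupported` from the three stubs** (the ONLY theorem of this file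
concluding the crux): the Hodge conjecture from `stub_middle` + `stub_pencil`
(`hodgeConjecture_of_middle_of_pencil`); then, per `X` and model `A`, the landed induction engine
`isotypic_le_supportedClasses_of_ingredients` (p117181) fed with semisimple splitting
(`stub_completelyReducible` + `smoothProjective_hodgeStructure_isPolarizable_holds`), Hodge lines
(`stub_rankOne`, supported by `stub_middle`), and phantoms: `stub_hodgeEffective` puts them in the
supremum of Hodge-correspondence images, which HC puts in `N¹`
(`hodgeCorrespondences_le_supportedClasses_of_hodgeConjecture`). -/
theorem TranscendentalOrSupported_of :
    Summit.HodgeConjecture.HodgeConjecture.Theses.LinearSystemTorelli.TranscendentalOrSupported := by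
  intro p X hp hX A r b hb hsub hbot j
  have hHC : _root_.HodgeConjecture := hodgeConjecture_of_middle_of_pencil stub_middle stub_pencil
  exact isotypic_le_supportedClasses_of_ingredients hX A
    (stub_completelyReducible smoothProjective_hodgeStructure_isPolarizable_holds hX A (2 * p))
    (stub_rankOne hX A p) (fun w hw hwt ↦ stub_middle hp hX w hw ⟨A, hwt⟩)
    (fun r' b' hb' hsub' hbot' hirr' hge' ↦
      le_trans (stub_hodgeEffective hp hX A r' b' hb' hsub' hbot' hirr' hge')
        (hodgeCorrespondences_le_supportedClasses_of_hodgeConjecture hHC hX))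
    _ (isotypic_span_isRationalClass_inter_eq hb) hsub hbot (Submodule.subset_span ⟨j, rfl⟩)

end Summit.HodgeConjecture.HodgeConjecture.Cruxes.TranscendentalOrSupported.HodgeEffectivity

end
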